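import Summits.CriticalPhenomena.PercolationContinuityZ3.Theorems.PercNearOneGluingNoHeavyLowerTailSahiOneStepLayerMonotone
import HarnessLib

/-!
# One-step scheme, `(2′)` for sub-block thresholds — LAYER MONOTONICITY WITH A FOREIGN FACTOR

Support file (prover prim-ineq-prove-3 gen 20; `--supports stmt-CriticalPhenomena-4575`; memo
`run/shared/lean/prim/prim-ineq-prove-3/FINDING-G20-COUPLING-SPLIT.md` §2–3).  No definitions, no named facts, no sorries.

For a product measure, a block `T`, an ARBITRARY increasing event `U` (not necessarily determined by `T`), an event `C`
determined by the complement of `T`, and `j ≤ k`: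
  `μ(U ∩ C ∩ {N_T = j}) · μ{N_T = k} ≤ μ(U ∩ C ∩ {N_T = k}) · μ{N_T = j}`   (`real_inter_inter_layer_mul_le`).
Proof: block Fubini over `T` / `Tᶜ` (`BHK2006.blockFubini`) writes `μ(U ∩ C ∩ {N_T = m})` as the average over the outside pattern `z`
of `1_C(z) · μ(U_z ∩ {N_T = m})` with the `T`-determined increasing section `U_z = {ω | (ω ∩ T) ∪ (z ∖ T) ∈ U}`
(`real_inter_inter_layer_eq_sum_section`), and gen 18's `real_inter_layer_mul_le` applies to every section.
This supplies hypotheses (F1)/(F2) of the grid reduction of the memo (Step 2 and the ball ≼ band step).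
-/

noncomputable section

namespace Summit.CriticalPhenomena.PercolationContinuityZ3.Theorems

namespace SahiOneStep

open MeasureTheory Finset
open Literature.Probability.Percolation (DeterminedBy determinedBy_iff prodBernoulli_real_eq_sum_weight_ind)
open Literature.Probability.LatticeModels (prodBernoulli)
open Literature.Probability.Percolation.DecisionTree (ind ind_of_mem ind_of_not_mem ind_nonneg)
open Literature.Probability.Percolation.BHK2006 (weight weight_nonneg blockFubini ind_inter)
open scoped Classical

variable {ι : Type*} [Fintype ι] [DecidableEq ι]

omit [Fintype ι] [DecidableEq ι] in
/-- Indicators agree at points with the same membership. [folklore] -/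
theorem ind_eq_ind_of_iff {α : Type*} {A : Set α} {x y : α} (h : x ∈ A ↔ y ∈ A) : ind A x = ind A y := by
  by_cases hx : x ∈ A
  · rw [ind_of_mem hx, ind_of_mem (h.1 hx)]
  · rw [ind_of_not_mem hx, ind_of_not_mem (fun hy => hx (h.2 hy))]

omit [Fintype ι] [DecidableEq ι] in
/-- The section `U_z = {ω | (ω ∩ T) ∪ (z ∖ T) ∈ U}` of an increasing event is increasing. [folklore] -/
theorem isUpperSet_section (T : Finset ι) {U : Set (Set ι)} (hU : IsUpperSet U) (z : Set ι) :
    IsUpperSet {ω : Set ι | ω ∩ (↑T : Set ι) ∪ z \ (↑T : Set ι) ∈ U} := by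
  intro ω ω' hle hω
  refine hU ?_ hω
  exact Set.union_subset_union (Set.inter_subset_inter_left _ hle) le_rfl

omit [Fintype ι] [DecidableEq ι] in
/-- The section `U_z` is determined by `T`. [folklore] -/
theorem determinedBy_section (T : Finset ι) (U : Set (Set ι)) (z : Set ι) :
    DeterminedBy {ω : Set ι | ω ∩ (↑T : Set ι) ∪ z \ (↑T : Set ι) ∈ U} (↑T : Set ι) := by
  rw [determinedBy_iff]
  intro ω ω' h
  simp only [Set.mem_setOf_eq]
  rw [h]

omit [Fintype ι] in
/-- A spliced configuration `ω ∩ T ∪ z ∖ T` lies in the `T`-layer `m` iff `ω` does. [folklore] -/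
theorem union_sdiff_mem_layer_iff (T : Finset ι) (m : ℕ) (ω z : Set ι) :
    ω ∩ (↑T : Set ι) ∪ z \ (↑T : Set ι) ∈ {ω' : Set ι | (T.filter (· ∈ ω')).card = m} ↔
      ω ∈ {ω' : Set ι | (T.filter (· ∈ ω')).card = m} := by
  refine (determinedBy_iff _ _).1 (determinedBy_layer T m) _ _ ?_
  ext i; by_cases hi : i ∈ (↑T : Set ι) <;> simp [hi]

omit [Fintype ι] in
/-- `ω ∩ T` lies in the `T`-layer `m` iff `ω` does. [folklore] -/
theorem inter_mem_layer_iff (T : Finset ι) (m : ℕ) (ω : Set ι) :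
    ω ∩ (↑T : Set ι) ∈ {ω' : Set ι | (T.filter (· ∈ ω')).card = m} ↔ ω ∈ {ω' : Set ι | (T.filter (· ∈ ω')).card = m} := by
  refine (determinedBy_iff _ _).1 (determinedBy_layer T m) _ _ ?_
  ext i; by_cases hi : i ∈ (↑T : Set ι) <;> simp [hi]

omit [Fintype ι] [DecidableEq ι] in
/-- An event determined by `Tᶜ` only sees the outside pattern: `ω ∩ T ∪ z ∖ T ∈ C ↔ z ∈ C`. [folklore] -/
theorem union_sdiff_mem_iff_of_determinedBy_compl (T : Finset ι) {C : Set (Set ι)} (hC : DeterminedBy C ((↑T : Set ι)ᶜ))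
    (ω z : Set ι) : ω ∩ (↑T : Set ι) ∪ z \ (↑T : Set ι) ∈ C ↔ z ∈ C := by
  refine (determinedBy_iff C _).1 hC _ _ ?_
  ext i; by_cases hi : i ∈ (↑T : Set ι) <;> simp [hi]

/-- **Block-Fubini form of `μ(U ∩ C ∩ {N_T = m})`**: the average over the outside pattern `z` (a full configuration, of which only
`z ∖ T` matters) of `1_C(z) · μ(U_z ∩ {N_T = m})`. [folklore] -/
theorem real_inter_inter_layer_eq_sum_section (p : ι → unitInterval) (T : Finset ι) (U : Set (Set ι)) {C : Set (Set ι)}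
    (hC : DeterminedBy C ((↑T : Set ι)ᶜ)) (m : ℕ) :
    (prodBernoulli p).real (U ∩ C ∩ {ω : Set ι | (T.filter (· ∈ ω)).card = m}) =
      ∑ z : Set ι, weight (fun e => (p e : ℝ)) z *
        (ind C z * (prodBernoulli p).real ({ω : Set ι | ω ∩ (↑T : Set ι) ∪ z \ (↑T : Set ι) ∈ U} ∩
          {ω : Set ι | (T.filter (· ∈ ω)).card = m})) := by
  set L : Set (Set ι) := {ω : Set ι | (T.filter (· ∈ ω)).card = m} with hL
  have hsum : ∑ ω : Set ι, weight (fun e => (p e : ℝ)) ω = 1 := Literature.Combinatorics.Sahi2008.sum_bernoulliWeight p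
  -- the integrand as a function of the two blocks
  set Φ : Set ι → Set ι → ℝ := fun x z => ind U (x ∩ (↑T : Set ι) ∪ z \ (↑T : Set ι)) * ind C z * ind L x with hΦ
  -- its value on the block projections
  have hΦ' : ∀ x z : Set ι, Φ (x ∩ (↑T : Set ι)) (z \ (↑T : Set ι)) =
      ind U (x ∩ (↑T : Set ι) ∪ z \ (↑T : Set ι)) * ind C z * ind L x := by
    intro x z
    simp only [hΦ]
    have h1 : x ∩ (↑T : Set ι) ∩ (↑T : Set ι) ∪ (z \ (↑T : Set ι)) \ (↑T : Set ι) = x ∩ (↑T : Set ι) ∪ z \ (↑T : Set ι) := by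
      ext i; by_cases hi : i ∈ (↑T : Set ι) <;> simp [hi]
    have h2 : ind C (z \ (↑T : Set ι)) = ind C z :=
      ind_eq_ind_of_iff ((determinedBy_iff C _).1 hC _ _ (by ext i; simp))
    have h3 : ind L (x ∩ (↑T : Set ι)) = ind L x := ind_eq_ind_of_iff (inter_mem_layer_iff T m x)
    rw [h1, h2, h3]
  have hF := blockFubini (fun e => (p e : ℝ)) (↑T : Set ι) Φ
  rw [hsum, one_mul] at hF
  -- left side: `μ(U ∩ C ∩ layer)`
  have hleft : ∀ ω : Set ι, Φ (ω ∩ (↑T : Set ι)) (ω \ (↑T : Set ι)) = ind (U ∩ C ∩ L) ω := by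
    intro ω
    rw [hΦ' ω ω, ind_inter, ind_inter]
    rw [Set.inter_union_sdiff]
  simp only [hleft] at hF
  rw [prodBernoulli_real_eq_sum_weight_ind, hF]
  simp_rw [Finset.mul_sum]
  rw [Finset.sum_comm]
  refine Finset.sum_congr rfl fun z _ => ?_
  rw [prodBernoulli_real_eq_sum_weight_ind, Finset.mul_sum, Finset.mul_sum]
  refine Finset.sum_congr rfl fun x _ => ?_
  rw [hΦ' x z, ind_inter]
  have h4 : ind {ω : Set ι | ω ∩ (↑T : Set ι) ∪ z \ (↑T : Set ι) ∈ U} x = ind U (x ∩ (↑T : Set ι) ∪ z \ (↑T : Set ι)) := by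
    by_cases hx : x ∩ (↑T : Set ι) ∪ z \ (↑T : Set ι) ∈ U
    · rw [ind_of_mem hx, ind_of_mem (show x ∈ {ω : Set ι | ω ∩ (↑T : Set ι) ∪ z \ (↑T : Set ι) ∈ U} from hx)]
    · rw [ind_of_not_mem hx, ind_of_not_mem (show x ∉ {ω : Set ι | ω ∩ (↑T : Set ι) ∪ z \ (↑T : Set ι) ∈ U} from hx)]
  rw [h4]
  ring

/-- **LAYER MONOTONICITY WITH A FOREIGN FACTOR.**  For a product measure, a block `T`, an increasing event `U` (arbitrary), an event `C`
determined by `Tᶜ`, and `j ≤ k`:  `μ(U ∩ C ∩ {N_T = j})·μ{N_T = k} ≤ μ(U ∩ C ∩ {N_T = k})·μ{N_T = j}`. [this work] -/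
theorem real_inter_inter_layer_mul_le (p : ι → unitInterval) (T : Finset ι) {U C : Set (Set ι)} (hU : IsUpperSet U)
    (hC : DeterminedBy C ((↑T : Set ι)ᶜ)) {j k : ℕ} (hjk : j ≤ k) :
    (prodBernoulli p).real (U ∩ C ∩ {ω : Set ι | (T.filter (· ∈ ω)).card = j}) *
        (prodBernoulli p).real {ω : Set ι | (T.filter (· ∈ ω)).card = k} ≤
      (prodBernoulli p).real (U ∩ C ∩ {ω : Set ι | (T.filter (· ∈ ω)).card = k}) *
        (prodBernoulli p).real {ω : Set ι | (T.filter (· ∈ ω)).card = j} := by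
  rw [real_inter_inter_layer_eq_sum_section p T U hC j, real_inter_inter_layer_eq_sum_section p T U hC k,
    Finset.sum_mul, Finset.sum_mul]
  refine Finset.sum_le_sum fun z _ => ?_
  have hw : 0 ≤ weight (fun e => (p e : ℝ)) z := weight_nonneg (fun e => (p e).2.1) (fun e => (p e).2.2) z
  have hc : 0 ≤ ind C z := ind_nonneg C z
  have key := real_inter_layer_mul_le p T (isUpperSet_section T hU z) (determinedBy_section T U z) hjk
  calc weight (fun e => (p e : ℝ)) z * (ind C z * (prodBernoulli p).real
          ({ω : Set ι | ω ∩ (↑T : Set ι) ∪ z \ (↑T : Set ι) ∈ U} ∩ {ω : Set ι | (T.filter (· ∈ ω)).card = j})) *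
        (prodBernoulli p).real {ω : Set ι | (T.filter (· ∈ ω)).card = k}
        = weight (fun e => (p e : ℝ)) z * ind C z * ((prodBernoulli p).real
          ({ω : Set ι | ω ∩ (↑T : Set ι) ∪ z \ (↑T : Set ι) ∈ U} ∩ {ω : Set ι | (T.filter (· ∈ ω)).card = j}) *
        (prodBernoulli p).real {ω : Set ι | (T.filter (· ∈ ω)).card = k}) := by ring
    _ ≤ weight (fun e => (p e : ℝ)) z * ind C z * ((prodBernoulli p).real
          ({ω : Set ι | ω ∩ (↑T : Set ι) ∪ z \ (↑T : Set ι) ∈ U} ∩ {ω : Set ι | (T.filter (· ∈ ω)).card = k}) *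
        (prodBernoulli p).real {ω : Set ι | (T.filter (· ∈ ω)).card = j}) :=
        mul_le_mul_of_nonneg_left key (mul_nonneg hw hc)
    _ = _ := by ring

end SahiOneStep

end Summit.CriticalPhenomena.PercolationContinuityZ3.Theorems
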